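import Summits.RiemannHypothesis.RiemannHypothesis.Theses.SignCone
import Summits.RiemannHypothesis.RiemannHypothesis.Theorems.SignConeConeMagnificationCompactness
import Literature.NumberTheory.LFunctions.WeilExplicit
import Literature.NumberTheory.LFunctions.GeneralizedRH
import Summits.RiemannHypothesis.RiemannHypothesis.Theorems.SignConeConeMagnificationStubFakePNT
import Summits.RiemannHypothesis.RiemannHypothesis.Theorems.SignConeConeMagnificationStubChebyshev
import Summits.RiemannHypothesis.RiemannHypothesis.Theorems.SignConeConeMagnificationStubContinuation
import Summits.RiemannHypothesis.RiemannHypothesis.Theorems.SignConeConeMagnificationStubTransfer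
import Summits.RiemannHypothesis.RiemannHypothesis.Theorems.SignConeConeMagnificationStubDeficitOfTorus
import Summits.RiemannHypothesis.RiemannHypothesis.Theorems.SignConeConeMagnificationStubPdLaplace
import Summits.RiemannHypothesis.RiemannHypothesis.Theorems.SignConeConeMagnificationStubCara
import Summits.RiemannHypothesis.RiemannHypothesis.Theorems.SignConeConeMagnificationStubDeficitOfDesign
import Summits.RiemannHypothesis.RiemannHypothesis.Theorems.SignConeConeMagnificationStubCombZeroSide
import Summits.RiemannHypothesis.RiemannHypothesis.Theorems.SignConeConeMagnificationStubCombZeroSideC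
import Summits.RiemannHypothesis.RiemannHypothesis.Theorems.SignConeConeMagnificationStubDesignOfTypes
import Summits.RiemannHypothesis.RiemannHypothesis.Theorems.SignConeConeMagnificationStubFakeMertens
import Summits.RiemannHypothesis.RiemannHypothesis.Theorems.SignConeConeMagnificationStubCombLocal
import Summits.RiemannHypothesis.RiemannHypothesis.Theorems.SignConeConeMagnificationStubCombType

/-!
# `SignCone.ConeMagnification` — line `Sketch` (landau-pinch architecture), skeleton r5
(item stmt-RiemannHypothesis-16303, route route-RiemannHypothesis-SignCone; crux dir
`Cruxes/ConeMagnification/`; idea cards `Ideas/landau-pinch.md` (architecture),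
`Ideas/forced-resonance-universality.md`, `Ideas/resonant-positive-witness.md`; line card `Lines/Sketch.md`)

CRUX: if at every cutoff `a > 0` some weight `c_a ≥ 0` on `ℕ` (`c_a 1 = 0`) has unit slack,
`-‖g‖₂² ≤ Re (W_ar(g ⋆ g̃) − P_{c_a}(g ⋆ g̃))` for all Weil tests `g` supported in `[-a, a]`, then RH.

REDUCTION ALREADY LANDED (`Theorems/SignConeConeMagnificationCompactness.lean`, p129201):
`coneMagnification_of_uniform` — it suffices to prove RH from ONE weight `c ≥ 0`, `c 1 = 0`, with unit
slack against EVERY Weil test (slack-cone compactness, W-MAG Thm 1.2(ii) shape).  Below, "`US c`"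
abbreviates that uniform unit-slack hypothesis, always written out verbatim (no local `def`).

THE LINE (r8: THIRTEEN stubs — NINE landed, FIVE open (`stub_fakeMertens`, `stub_combZeroSideC`, `stub_combLocal`, `stub_combType`,
`stub_designOfTypes` = the core) — composed gap-free in
`ConeMagnification_of`, which since r5 first splits `by_cases RiemannHypothesis` (the RH branch is trivial:
the crux concludes RH), so the open stub carries `¬ RiemannHypothesis` as a usable hypothesis; r6 moved the open core to the
2001 design interface and r7 records that its two neighbours `stub_combZeroSide`, `stub_deficitOfDesign` landed in wave 1):

* `stub_fakePNT` (LANDED p130740) — positive-definiteness of the unit-slack form on translate mixes ⇒ smoothed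
  fake prime number theorem with `O(1)` error:
  `Σₙ c(n) n^{-1/2} (K(x + log n) + K(x − log n)) = e^{x/2} K̂(0) + e^{-x/2} K̂(1) + O_g(1)` uniformly in `x`.
* `stub_chebyshev` (LANDED p131015) — ⇒ `Σ c(n) n^{-σ} < ∞` for `σ > 1`.
* `stub_continuation` (LANDED p130893) — Laplace transform ⇒ thin-rectangle continuation of `L_c − 1/(s−1)`
  through every point of `re s > 1/2`.
* `stub_pdLaplace` (LANDED p132066) — `Re ∫₀^∞ ⟨D, K(·−y)⟩ e^{-zy} dy ≥ 0` (`Re z > 0`).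
* `stub_cara` (LANDED p133591, + aux p133402) — Carathéodory description (2001 swcm Thm A♭, necessity): ONE
  holomorphic `F = L_c − 1/(s−1)` on `re s > 1/2` with `Re F ≤ 1/2 + Re(1/s) + 𝒜(s) − ½log π`,
  `𝒜` = Poisson extension of `Re ψ(1/4+iv/2)` (`= ½ Re ψ(s/2)`).
* `stub_torusOfCara_offline` (OPEN CORE; r5 reshape of r4's `stub_torusOfCara`) — for a weight `c ≥ 0`,
  `c 1 = 0`, with UNIT SLACK against every Weil test, `Σ c n^{-σ} < ∞ (σ > 1)` and the Carathéodory majorant,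
  AND ASSUMING `¬RH`: the Riesz–Fejér torus inequality
  `Σ_{A⊆S} (c−Λ)(n_A) n_A^{-1/2} 2^{-|A|} cos(|A|φ) ≤ 1/2` for every finite prime set `S` and phase `φ`.
  WHY THIS SHAPE (lead c1 analysis, `Lines/Sketch.md` §r5):
  (a) under RH the crux needs nothing, so only the `¬RH` world matters; there, by the landed transfer
      (`stub_transfer` contraposed: `¬RH → hcont → hsum → ¬hdef`) and `stub_deficitOfTorus`, the torus conclusion
      is equivalent to `False` — the stub is exactly THM X "a uniform unit-slack weight cannot coexist with an
      off-line zero" (= W-MAG ∧ W-EFFMAG of the 2001 archive), no stronger and no weaker;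
  (b) the r4 statement also demanded the torus inequality IN THE RH WORLD for every infinite-support member of
      the cone — not needed by the crux and the one place a refutation could live (a member whose boundary
      measure `θ_{c−Λ}` has positive singular mass on zeta zeros: `T_{S,φ}(c−Λ) ≤ 1/2 + limsup_a mean(R_a θ_s⁺)`
      by the Herglotz representation, and nothing in the Cara data alone excludes `θ_s⁺ ≠ 0`); the two landed
      special cases (finite support p133361, ℓ¹(n^{-1/2}) modifications p133660) are exactly the ones with
      `θ_s⁺ = 0` for free;
  (c) the unit-slack form itself (Weil tests) is handed to the prover: every known passage to the deficit
      (2001 W-MAG §2–4: ζ-mollified resonator combs through `explicit_formula_holds`, the [CV]-type twisted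
      second moment, the design/type inequality eq:LO and absolute summability AX-A feeding the kernel-checked
      finite spine `reserve/prior-2001/…/Rh_WMagnificationY1_MagDeficit.lean`) works with tests, not with the
      majorant; `stub_fakePNT`/`stub_continuation`/`stub_pdLaplace` re-derive `hPNT`/`hcont`/`hPD` by name.
  DIFFICULTY FLOOR (Calibration p132538): applied to `c ≡ 𝟙_{n≥2}` the stub yields `Cara(𝟙) ∧ US(𝟙) → RH`, so
  any proof contains an Ω₊ theorem `Re ζ(s) > 3/2 + Re(1/s+1/(s−1)) + ½Re ψ(s/2) − ½log π` somewhere in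
  `re s > 1/2` (resonance-method strength relative to `½ log t`); inside the comb calculus this is the
  twisted-second-moment evaluation.  DEAD SHORTCUTS (do not retry): direct node-nonnegative two-bump
  witnesses (off-line gain `e^{(β₀−1/2)D}` < prime main term `e^{D/2}` for every support length `D`);
  positivity-dropped combs (the dropped off-diagonal `c`-terms cost `OffDiag_Λ ≍ κ'L·log M·B₀(0) ≫ ‖g‖²`);
  exactly-diagonal combs (bump width `1/(LM)` puts `ĝ` at heights `≤ LM` where a length-`M` mollifier does not
  mollify: the zero side regains `(log(LM)/2π)·‖g‖²`); Bohr means on a line `re s = σ` (lose `½ log T`).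
* `stub_deficitOfTorus` (LANDED p131512) — torus inequality ⇒ `Σ_p (log p − c(p))₊ /√p ≤ 2` (Fejér) ⇒
  summability of `Σ_p (log p − c(p))₊ p^{-σ}`, `σ > 1/2`.
* `stub_transfer` (LANDED p130783) — Landau transfer: continuation + deficit summability ⇒ RH.

`ConeMagnification_of` = `coneMagnification_of_uniform` ∘ (by_cases RH; transfer ∘ (chebyshev, continuation ∘
 fakePNT, deficitOfTorus ∘ torusOfCara_offline ∘ (cara ∘ pdLaplace, ¬RH))).
Literature vocabulary (`IsWeilTest`, `weilConv`, `weilReflect`, `weilMellin`, `weilPolarTerm`,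
`weilArchTerm`) is definitionally the item's Mathlib-primitive vocabulary (route CONE NOTE, `Iff.rfl`).
-/

noncomputable section

-- `Summit.RiemannHypothesis.RiemannHypothesis.…` repeats a namespace component by design (D-0017 layout).
set_option linter.dupNamespace false

open scoped BigOperators ComplexConjugate Topology
open Complex MeasureTheory Set Filter

namespace Summit.RiemannHypothesis.RiemannHypothesis.Cruxes.ConeMagnification.Sketch

open Literature.NumberTheory.LFunctions
open Summit.RiemannHypothesis.RiemannHypothesis.Theorems.SignCone
open Summit.RiemannHypothesis.RiemannHypothesis.Theorems.SignConeConeMagnification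

/-! ### The registered stubs (signatures over existing declarations only) -/

/-! Stubs `stub_fakePNT` (p130740), `stub_chebyshev` (p131015), `stub_pdLaplace` (p132066), `stub_cara`
(p133591), `stub_deficitOfTorus` (p131512) are LANDED in namespace `…Theorems.SignConeConeMagnification`;
`stub_continuation` (p130893) and `stub_transfer` (p130783) in this file's namespace
`…Cruxes.ConeMagnification.Sketch` (all imported above).  Reshape history: r2 split the monolithic
`stub_deficit` (W-MAG Thm 1.2(i)) into `stub_torusIneq` + the finite Fejér spine `stub_deficitOfTorus`; r3 split
`stub_torusIneq` into `stub_pdLaplace` → `stub_cara` → `stub_torusOfCara`; r5 (lead c1) replaces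
`stub_torusOfCara` by `stub_torusOfCara_offline` (same conclusion; hypotheses `¬RH` and unit slack added; the
composition now splits `by_cases RiemannHypothesis`). -/

/-! #### r6 (lead c1, same cycle): the open core is restated in the 2001 DESIGN-INEQUALITY interface and split
three ways.  Why: every known passage to the prime deficit is a resonator-comb calculus whose OUTPUT is not the
pollution-free torus inequality at `σ = 1/2` but (i) absolute summability `Σ |c−Λ|(n)/n < ∞` (AX-A), (ii) a composite-mass
bound (AX-B) and (iii) the design/type inequality eq:LO `Σ_n ((c−Λ)(n)/n)·Φ_{S,a,φ}(n) ≤ M/2` for Riesz–Euler profiles `Φ`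
(which see every `n = n_A·k`, `k` coprime to `S`: "pollution") (AX-C) — and the passage from (i)–(iii) to the deficit is the
finite spine of W-MAG §5, kernel-checked in the prior programme's stockroom
(`reserve/prior-2001/Prior/RiemannHypothesis/RiemannHypothesis/Rh_WMagnificationY1_MagDeficit.lean`, `deficit_summable`,
GREEN over exactly this interface).  So: `stub_combZeroSide` (c-free, unconditional, provable now: ζ-mollified combs are
Weil-neutral), `stub_designOfOffline` (THE OPEN CORE: ¬RH + unit slack + Cara data + comb zero side ⇒ AX-A ∧ AX-B ∧ AX-C
at `M = 1`; under its hypotheses ≡ `False` ≡ THM X, exactly as in r5), `stub_deficitOfDesign` (the spine: AX-A → AX-B → AX-C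
→ deficit summability for `σ > 1/2`; adapt the stockroom file).  `stub_deficitOfTorus` (p131512) stays landed, now unused. -/

/-! **Stub Z — `stub_combZeroSide` is LANDED** (wave 1, p140318, `Theorems/SignConeConeMagnificationStubCombZeroSide.lean`,
namespace `…Theorems.SignConeConeMagnification`; c-free and unconditional: ζ-mollified resonator combs
`g(u) = Σ_{m≤LM} (α⋆β_M)_m b₁((u−log m)M/κ)`, `κ = (log M)^θ`, satisfy `|Re(W_ar(K) − P_Λ(K))| ≤ ε‖g‖₂²` for `M ≥ M₀(α,L,b₁,θ,ε)`;
supporting Literature landed with it: `ZetaTruncationUniform` p137124 (Titchmarsh (4.11.1)), `ZeroSumSobolev` p137320,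
`DirichletPolynomialStripMeanValue` p137526, `ZetaPartialSumAtZeros` p137650, `ZetaPartialSumZeroBlocks` p138247,
`ZetaPartialSumLowZeros` p138399, `ZetaPartialSumZeroTotal` p138728, `WeilLogLatticeComb` p137910, `DivisorCombFactorisation` p138006,
`WeilCombZeroSide` p139141, `WeilLogLatticeCombNorm` p139373, `MollifiedCoefficientsMeanSquare` p139699, `WeilCombNormLowerBound` p140031). -/


/-! #### r8 (lead c1): the comb EVALUATION is no longer an unlocated gap.
Organising the node sum BY NODE (Poisson summation along each progression `ℓk`, then the free sum over `k'` for fixed `n`)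
shows that the off-diagonal mass of the mollified comb splits into a SMOOTH part (the `j = 0` Poisson mode; its
`c`-versus-`Λ` discrepancy is `O((κ/M)²·LM)`, i.e. `O(κL/log M)·‖g‖²`, from Mertens-level information
`Σ_{n≤x}(c−Λ)(n)/n = O(1)` alone) and an ARITHMETIC part which after the `k'`-sum depends on `n` only through
`gcd(nℓ',ℓ)` and `log n` — reproducing the [CV] gcd form `Φ_α(n) = Σ_{ℓ,ℓ'} α_ℓ ᾱ_ℓ' gcd(nℓ',ℓ)/√(ℓℓ')` times `log(M/κn)`
plus a bounded secondary gcd-profile, with all errors `O(κ/log M)·‖g‖²` (validated numerically: compute/combcheck.py,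
per-node agreement 10⁻³–10⁻⁴ in the comb regime).  No statement about `c` in short windows or in invertible residue
classes is needed.  Hence the split below: `stub_fakeMertens` (Mertens-level input from the fake PNT), `stub_combZeroSideC`
(complex-coefficient zero side), `stub_combLocal` (comb evaluation + 2-point designs `δ₁ + tδ_p`, `t` of both signs ⇒
`Σ_{p∣n} c(n)/n < ∞` for every prime `p`), `stub_combType` (the TYPE INEQUALITY `Σ_n ((c−Λ)(n)/n)·Re Φ_α(n) ≤ ½Φ_α(1)` for every
finitely supported complex design), `stub_designOfTypes` (OPEN CORE: type inequalities + everything else ⇒ AX-A ∧ AX-B ∧ AX-C;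
the 2001 §3–5 design algebra — Riesz–Euler products over the DEFICIT primes only, rotation `e^{iφ}` and Fejér `|b₁| ≤ 2b₀`,
pollution control; whether the type inequalities alone suffice is not settled — unit slack and the Carathéodory data stay
available as hypotheses). -/

-- (`stub_fakeMertens` is LANDED; local stubbed copy removed in the seat-0 assembly draft)

-- (`stub_combZeroSideC` is LANDED; local stubbed copy removed in the seat-0 assembly draft)

-- (`stub_combLocal` is LANDED; local stubbed copy removed in the seat-0 assembly draft)

-- (`stub_combType` is LANDED: `…Theorems.SignConeConeMagnificationStubCombType`, seat-0 F4)

-- (`stub_designOfTypes` is LANDED; local stubbed copy removed in the seat-0 assembly draft)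

/-! **Stub 4d — `stub_deficitOfDesign` is LANDED** (wave 1, p137772, `Theorems/SignConeConeMagnificationStubDeficitOfDesign.lean`,
namespace `…Theorems.SignConeConeMagnification`; the finite spine of W-MAG §5 adapted from the stockroom `MagDeficit` file:
AX-A → AX-B → AX-C(1/2) → `∀ σ > 1/2, Summable deficit·p^{-σ}`; with `…DesignDefs` p137034 (vocabulary, namespace `….Design`),
`…DesignSpineA` p137424, `…DesignSpineB` p137583). -/


/-! ### The composition (gap-free glue; concludes the crux BY NAME) -/

/-- **`SignCone.ConeMagnification` from the stubs.**  By slack-cone compactness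
(`coneMagnification_of_uniform`, landed) it suffices to treat ONE weight `c ≥ 0`, `c 1 = 0`, with unit
slack against every Weil test; if RH holds there is nothing to do; otherwise `stub_fakePNT` and
`stub_continuation` continue `L_c − 1/(s−1)`, `stub_pdLaplace` → `stub_cara` give the Carathéodory majorant,
`stub_designOfOffline` (fed `¬RH`, the unit slack and the c-free comb zero-side lemma `stub_combZeroSide`) gives the
2001 design data, `stub_deficitOfDesign` (finite spine) bounds the prime deficit, and `stub_transfer` (Landau)
concludes RH (`stub_chebyshev` supplies absolute convergence of `L_c` on `re s > 1`). [folklore] -/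
theorem ConeMagnification_of :
    Summit.RiemannHypothesis.RiemannHypothesis.Theses.SignCone.ConeMagnification := by
  refine coneMagnification_of_uniform ?_
  rintro ⟨c, hc0, hc1, hU⟩
  by_cases hRH : RiemannHypothesis
  · exact hRH
  have hPNT := stub_fakePNT c hc0 hU
  have hsum := stub_chebyshev c hc0 hPNT
  have hcont := stub_continuation c hc0 hPNT hsum
  have hPD := stub_pdLaplace c hc0 hU
  have hF := stub_cara c hc0 hc1 hU hsum hcont hPD
  have hM := stub_fakeMertens c hc0 hPNT
  have hLoc := stub_combLocal c hc0 hc1 hU hM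
  have hZc := stub_combZeroSideC
  have hTI := stub_combType c hc0 hc1 hU hM hLoc hZc
  obtain ⟨hA, hB, hC⟩ := stub_designOfTypes hRH c hc0 hc1 hU hsum hF hM hLoc hTI
  have hdef := stub_deficitOfDesign c hc0 hc1 hA hB hC
  exact stub_transfer c hc0 hsum hcont hdef

end Summit.RiemannHypothesis.RiemannHypothesis.Cruxes.ConeMagnification.Sketch

namespace Summit.RiemannHypothesis.RiemannHypothesis.Theorems

/-- **The crux `SignCone.ConeMagnification`, proved** (line `Sketch` r9 of stmt-RiemannHypothesis-16303: the composition
`Cruxes.ConeMagnification.Sketch.ConeMagnification_of` of the thirteen landed stubs). [folklore] -/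
theorem ConeMagnification_proof :
    Summit.RiemannHypothesis.RiemannHypothesis.Theses.SignCone.ConeMagnification :=
  Summit.RiemannHypothesis.RiemannHypothesis.Cruxes.ConeMagnification.Sketch.ConeMagnification_of

end Summit.RiemannHypothesis.RiemannHypothesis.Theorems

end
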